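import Summits.ResolutionOfSingularities.ResolutionOfSingularities.Theorems.WeightedInvariantIota3DropCurveB
import Summits.ResolutionOfSingularities.ResolutionOfSingularities.Theorems.WeightedInvariantContactCylinderDescent
import Summits.ResolutionOfSingularities.ResolutionOfSingularities.Theorems.WeightedInvariantJFlatEssSmoothMonomial
import Summits.ResolutionOfSingularities.ResolutionOfSingularities.Theorems.WeightedInvariantIota3TauDescentAdaptedRsp
import Literature.AlgebraicGeometry.Resolution.RegularLocalHeights
import HarnessLib

/-!
# (D-b³-curve-S) PROVED: the `S`-side INTEGER-CONTACT DATUM at the canonical curve centre of a three-dimensional door position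
# (door `HypersurfaceCentreConstruction`, stmt-ResolutionOfSingularities-19897; gap list of `stub_keyRungGrHomLE_three`)

Helper for `stub_keyRungGrHomLE_three` (def-free, `--supports 19897`).  Sequel of …Iota3DropCurveB (hand -7:
(D-b³-curve) ⟸ an `S`-side rsp-adapted tie-free transversal datum presenting `J₃ᵗ`).

* **`Iota3.exists_curve_datum`** — at a door position `(S, f)` (`S` regular local essentially of finite type over a field,
  `ringKrullDim S = 3`, `0 ≠ f ∈ 𝔪²`) with canonical centre `P` (`topStratum ι₀ S f = V(P)`, `S ⧸ P` regular, `¬ dim S_P ≤ 1`)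
  which is a CURVE (`P ≠ 𝔪`): there are a regular system of parameters `(y, x, z)` of `S` with `(y, x) = P`, an integer
  `b ≥ 1` and `ν = ord f ≥ 1` with `f ∈ 𝔪^ν ∖ 𝔪^{ν+1}`, `f ∈ 𝒥_{bν}((y, x); (b, 1))` and
  `jFlatT S f = 𝒥((y, x); (b, 1))` (all degrees).  ASSEMBLY of tree bricks: `J₃ᵗ =` cylinder over `P` of `jContact (S_P)`
  (`jFlatT_eq_cylinderAt_jContact`, `dim S_P ≤ 2`); `f/1` is not of monomial type at `S_P`
  (`JFlatEssSmooth.not_isMonomialType_of_topStratumPrime_eq`); MAXIMISER DESCENT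
  (`ContactCylinder.Descent.exists_pair_maximiser_of_essFiniteType`: the terminal integer contact level `b = b_max (f/1)` of
  `S_P` is reached by `y/1` for a pair `(x, y) ⊆ S` with independent differentials generating `P`), fed by an adapted regular
  system of parameters (`Iota3.exists_rsp_adapted`) and equimultiplicity along `V(P)` (`topStratumPrime_iotaOrdEpsTau_spec`,
  `EquimultipleCentre.iotaOrd_localization_eq_of_mem_pow`); the cylinder VALUE
  (`ContactCylinder.cylinder_comap_eq_weightedMonomialIdeal`: `(jContact (S_P) (f/1) m) ∩ S = 𝒥ₘ((x, y); (1, b))`).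
* The sequel …KeyRungThreeOfDropCurveTie turns this into THE GAP LISTS OF RECORD: (D-b³) is demanded only (i) at POINT centres
  (`P = 𝔪`: ISOLATED / TIE / CROSSING) and (ii) at CURVE centres whose integer-contact datum is TIED —
  `f ∈ 𝒥_{(b+1)ν}((x, y − λx^b, z); (1, b+1, 1))` for some `λ ∈ S`, or `b = 1` and `f ∈ 𝒥_{2ν}((y, x, z); (1, 2, 1))` — the tie-free
  curve centres being settled by hand -7's `Iota3.dropb3_curve_of_tieFree_datum` (ORDER drop at every successor over the closed point).

REMARK (why (ii) is not empty and not an order drop).  `J₃ᵗ` reads the P2 centre `jContact` at `S_P`, whose contact level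
`b = b_max ∈ ℕ` is the INTEGER PART of the Abramovich–Quek–Schober slope `r/q` of `f/1`; the letter `τ` tests the AQS tie
(weights `(q, r+1, 1)`).  When `r/q ∉ ℕ` a `τ = 0` curve centre can carry an integer tie: `f = y² + z x³` (`k` perfect,
`char k ≠ 2, 3`, `S = k[x,y,z]_{(x,y,z)}`, `P = (y, x)`, `b = 1`, AQS slope `3/2`, no AQS tie) has the `t`-homogeneous successor
`𝔫 = (t⁻¹, yt, z)` of `S[t⁻¹, yt, xt]` over `𝔪` with strict transform `(yt)² + z (xt)³ t⁻¹` of ORDER `2 = ν`; there `ε = τ = 0`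
persist and the drop of `ι₃ᵗ` is carried by the ratio letter `σ₁` (`3 ↦ 2`).  So (ii) is a `σ`-drop statement, like the point regimes.
[OURS · L1 W4.3 · audit glue; AI work, weaker than expert review; nothing here is a statement of the manuscript under review.]

## References

* V. Cossart, U. Jannsen, S. Saito, LNM 2270 (2020), Ch. 8 (maximal contact in dimension two). [CossartJannsenSaito2020]
* D. Abramovich, M. H. Quek, B. Schober, arXiv:2507.01232 (2025), Thm 1.3 (3), Thm 3.5. [AbramovichQuekSchober2025]
* H. Matsumura, *Commutative Ring Theory* (1987), Thm. 14.2, §5. [Matsumura1987]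
-/

noncomputable section

set_option linter.dupNamespace false -- mandated namespace of this single-conjunct summit

open IsLocalRing Literature.AlgebraicGeometry.Resolution
open Summit.ResolutionOfSingularities.ResolutionOfSingularities.Theorems
open Summit.ResolutionOfSingularities.ResolutionOfSingularities.Theorems.ContactCylinder

namespace Summit.ResolutionOfSingularities.ResolutionOfSingularities.Cruxes.HypersurfaceCentreConstruction.LocalEngine

namespace Iota3

/-! ## §1 Small bookkeeping -/

/-- `Set.range ![a, b, c] = {a, b, c}`. [folklore] -/
theorem range_three {S : Type} (a b c : S) : Set.range ![a, b, c] = {a, b, c} := by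
  rw [Matrix.range_cons, Matrix.range_cons, Matrix.range_cons, Matrix.range_empty, Set.union_empty,
    Set.singleton_union, Set.singleton_union]

/-- **At a curve centre of a threefold the quotient is one-dimensional**: `S` regular local of Krull dimension `3`, `P` a prime with
`¬ dim S_P ≤ 1` and `P ≠ 𝔪` has `dim (S ⧸ P) = 1` (heights in a regular, hence catenary, local ring). [cite: Matsumura1987, §5] -/
theorem ringKrullDim_quotient_eq_one_of_curveCentre {S : Type} [CommRing S] [IsRegularLocalRing S] (hd : ringKrullDim S = 3)
    (P : Ideal S) [P.IsPrime] (hreg : IsRegularLocalRing (S ⧸ P)) (hP1 : ¬ ringKrullDim (Localization.AtPrime P) ≤ 1)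
    (hPm : P ≠ maximalIdeal S) : ringKrullDim (S ⧸ P) = 1 := by
  have hdle : ringKrullDim S ≤ 3 := le_of_eq hd
  obtain ⟨hP, hhP, -⟩ := exists_height_eq_nat_of_ringKrullDim_le_three hdle P
  have hP2 : ringKrullDim (Localization.AtPrime P) ≤ 2 := ringKrullDim_localization_le_two_of_ne hdle P hPm
  rw [IsLocalization.AtPrime.ringKrullDim_eq_height P (Localization.AtPrime P), hhP] at hP1 hP2
  have hcoe : ∀ a b : ℕ, ((a : ℕ∞) : WithBot ℕ∞) ≤ ((b : ℕ∞) : WithBot ℕ∞) ↔ a ≤ b := fun a b => by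
    rw [WithBot.coe_le_coe, ENat.coe_le_coe]
  have h2 : hP = 2 := by
    have h2' : hP ≤ 2 := (hcoe hP 2).mp hP2
    have h1' : ¬ hP ≤ 1 := fun h => hP1 ((hcoe hP 1).mpr h)
    omega
  have hsum := height_add_ringKrullDim_quotient P
  rw [hhP, h2, hd, ← hreg.spanFinrank_maximalIdeal] at hsum
  -- `hsum : ((2 : ℕ∞) : WithBot ℕ∞) + (d : WithBot ℕ∞) = 3`, `d = spanFinrank 𝔪_{S ⧸ P}`
  have hfin : (maximalIdeal (S ⧸ P)).spanFinrank = 1 := by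
    set d := (maximalIdeal (S ⧸ P)).spanFinrank with hddef
    norm_cast at hsum
    have h5 : 2 + d = 3 := by exact_mod_cast hsum
    omega
  rw [← hreg.spanFinrank_maximalIdeal, hfin]; rfl

/-! ## §2 The integer-contact datum at a curve centre -/

/-- **(D-b³-curve-S) — THE `S`-SIDE INTEGER-CONTACT DATUM AT A CURVE CENTRE.**  See the module docstring.
[OURS · L1 W4.3 · (D-b³-curve-S)] [cite: CossartJannsenSaito2020, Ch. 8] [cite: Matsumura1987, Thm. 14.2] -/
theorem exists_curve_datum (k₀ : Type) [Field k₀]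
    (S : Type) [CommRing S] [Algebra k₀ S] [Algebra.EssFiniteType k₀ S] [IsRegularLocalRing S]
    (f : S) (hd : ringKrullDim S = 3) (hf0 : f ≠ 0) (hf : f ∈ maximalIdeal S)
    (P : Ideal S) [P.IsPrime] (hreg : IsRegularLocalRing (S ⧸ P))
    (hE : topStratum iotaOrdEpsTau S f = {𝔮 | P ≤ 𝔮.asIdeal}) (hP1 : ¬ ringKrullDim (Localization.AtPrime P) ≤ 1)
    (hPm : P ≠ maximalIdeal S) :
    ∃ (y x z : S) (b ν : ℕ), Ideal.span (Set.range ![y, x, z]) = maximalIdeal S ∧ (maximalIdeal S).spanFinrank = 3 ∧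
      Ideal.span (Set.range ![y, x]) = P ∧ 1 ≤ b ∧ 1 ≤ ν ∧
      f ∈ maximalIdeal S ^ ν ∧ f ∉ maximalIdeal S ^ (ν + 1) ∧
      f ∈ weightedMonomialIdeal ![y, x] ![b, 1] (b * ν) ∧
      ∀ m : ℕ, jFlatT S f m = weightedMonomialIdeal ![y, x] ![b, 1] m := by
  classical
  haveI : IsDomain S := isDomain_of_isRegularLocalRing S
  have hdle : ringKrullDim S ≤ 3 := le_of_eq hd
  have hd3 : ringKrullDim S = (3 : ℕ) := by rw [hd]; rfl
  have hrk : (maximalIdeal S).spanFinrank = 3 := by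
    have h := IsRegularLocalRing.spanFinrank_maximalIdeal (R := S)
    rw [hd3] at h
    exact_mod_cast h
  -- the order `ν` of `f` and equimultiplicity along `V(P)`
  obtain ⟨ν, hν⟩ := Ordinal.lt_omega0.mp (iotaOrd_lt_omega0_of_ne_zero S hf0)
  obtain ⟨hfν, hfν1⟩ := (iotaOrd_eq_natCast_iff S f ν).mp hν
  have hP₀ : topStratumPrime iotaOrdEpsTau S f = P :=
    ContactCylinder.topStratumPrime_eq_of_topStratum_eq iotaOrdEpsTau S f hE
  obtain ⟨_, -, -, -, -, hfPν⟩ := topStratumPrime_iotaOrdEpsTau_spec hdle hf0 hf hν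
  rw [hP₀] at hfPν
  have hν1 : 1 ≤ ν := by
    by_contra h
    have h0 : ν = 0 := by omega
    rw [h0, zero_add, pow_one] at hfν1
    exact hfν1 hf
  -- the dimension of `S_P` and of `S ⧸ P`; an adapted regular system of parameters `(x₀, y₀, z₀)`
  have hdimP : ringKrullDim (Localization.AtPrime P) ≤ 2 := ringKrullDim_localization_le_two_of_ne hdle P hPm
  have hq1 : ringKrullDim (S ⧸ P) = 1 := ringKrullDim_quotient_eq_one_of_curveCentre hd P hreg hP1 hPm
  haveI := hreg
  obtain ⟨x₀, y₀, z₀, hxyz₀, hxy₀⟩ := exists_rsp_adapted hd3 P hq1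
  have hr₀ : Ideal.span (Set.range ![x₀, y₀, z₀]) = maximalIdeal S := by rw [range_three]; exact hxyz₀
  have hxg : ∀ i, (![x₀, y₀] : Fin 2 → S) i ∈ maximalIdeal S := LocalGameEFTCylinder.mem_maximalIdeal_pair hr₀
  have hli := LocalGameEFTCylinder.linearIndependent_toCotangent_pair hr₀ hrk
  -- the position `(S_P, f/1)`: non-zero, not of monomial type, of order `ν`
  have hf0' : algebraMap S (Localization.AtPrime P) f ≠ 0 := fun h =>
    hf0 ((injective_iff_map_eq_zero _).mp
      (IsLocalization.injective (Localization.AtPrime P) P.primeCompl_le_nonZeroDivisors) f h)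
  obtain ⟨hmax₀, hg₀2, -, -⟩ := Descent.pair_facts P hxg hli hxy₀
  have hnm : ¬ IsMonomialType (algebraMap S (Localization.AtPrime P) f) := by
    subst hxy₀
    exact JFlatEssSmooth.not_isMonomialType_of_topStratumPrime_eq hdle hf0 hf x₀ y₀ hxg hli hP₀
  have hy₀mem : algebraMap S (Localization.AtPrime P) y₀ ∈ maximalIdeal (Localization.AtPrime P) :=
    hmax₀ ▸ Ideal.subset_span (by simp)
  obtain ⟨νO, -, hνO, hνO1, hfνO, hfνO1⟩ := exists_adicOrder_eq_of_not_isMonomialType hf0' hnm ⟨_, hy₀mem, hg₀2⟩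
  have hιO : iotaOrd (Localization.AtPrime P) (algebraMap S (Localization.AtPrime P) f) = νO :=
    (iotaOrd_eq_natCast_iff _ _ νO).mpr ⟨hfνO, hfνO1⟩
  have hιP : iotaOrd (Localization.AtPrime P) (algebraMap S (Localization.AtPrime P) f) = iotaOrd S f :=
    EquimultipleCentre.iotaOrd_localization_eq_of_mem_pow P le_rfl hν hfPν
  have hνeq : νO = ν := by
    have h : ((νO : ℕ) : Ordinal.{0}) = ν := by rw [← hιO, hιP, hν]
    exact_mod_cast h
  have heq : f ∉ maximalIdeal S ^ ((adicOrder (algebraMap S (Localization.AtPrime P) f)).toNat + 1) := by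
    rw [hνO, hνeq]; exact hfν1
  -- MAXIMISER DESCENT: `b = b_max (f/1) ≥ 1` is reached by `g'/1` for a pair `(x', g') ⊆ S` generating `P`
  obtain ⟨hb, x', g', hP', hxg', hli', hreach⟩ :=
    Descent.exists_pair_maximiser_of_essFiniteType P k₀ hq1 hxg hli hxy₀ hf0' hnm heq
  set b := bMax (algebraMap S (Localization.AtPrime P) f) with hbdef
  -- the cylinder VALUE `(jContact (S_P) (f/1) m) ∩ S = 𝒥ₘ((x', g'); (1, b))` and `J₃ᵗ = 𝒥((g', x'); (b, 1))`
  obtain ⟨hmax', hg'2, -, -⟩ := Descent.pair_facts P hxg' hli' hP'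
  have hcyl : ∀ m : ℕ, (jContact (Localization.AtPrime P) (algebraMap S (Localization.AtPrime P) f) m).comap
      (algebraMap S (Localization.AtPrime P)) = weightedMonomialIdeal ![x', g'] ![1, b] m := by
    subst hP'
    exact fun m => cylinder_comap_eq_weightedMonomialIdeal S x' g' hxg' hli' f hf0' hnm hreach hb m
  have hJ : ∀ m : ℕ, jFlatT S f m = weightedMonomialIdeal ![g', x'] ![b, 1] m := fun m => by
    rw [jFlatT_eq_cylinderAt_jContact S f m hE hdimP, cylinderAt_def, hcyl m, AQSHeightTwo.weightedMonomialIdeal_swap]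
  -- admissibility `f ∈ 𝒥_{bν}((g', x'); (b, 1))`
  have hadm : f ∈ weightedMonomialIdeal ![g', x'] ![b, 1] (b * ν) := by
    rw [← hJ (b * ν), jFlatT_eq_cylinderAt_jContact S f _ hE hdimP, cylinderAt_def, Ideal.mem_comap,
      ← weightedMonomialIdeal_eq_jContact (Localization.AtPrime P) hf0' hnm hmax' hg'2 hb hreach (b * ν),
      ContactFiltration.weightedMonomialIdeal_eq_contactFiltration hmax' hb, ← contactFiltration_def, ← hνeq, ← hνO]
    exact hreach
  -- the regular system of parameters `(g', x', z₀)`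
  have hrsp : Ideal.span (Set.range ![g', x', z₀]) = maximalIdeal S := by
    rw [range_three, span_triple_eq_sup, Ideal.span_pair_comm, hP', ← hxy₀, ← span_triple_eq_sup, hxyz₀]
  have hPgx : Ideal.span (Set.range ![g', x']) = P := by
    rw [show Set.range ![g', x'] = {g', x'} by
      rw [Matrix.range_cons, Matrix.range_cons, Matrix.range_empty, Set.union_empty, Set.singleton_union],
      Ideal.span_pair_comm, hP']
  exact ⟨g', x', z₀, b, ν, hrsp, hrk, hPgx, hb, hν1, hfν, hfν1, hadm, hJ⟩

end Iota3

end Summit.ResolutionOfSingularities.ResolutionOfSingularities.Cruxes.HypersurfaceCentreConstruction.LocalEngine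

end
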